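import Summits.QuantumFields.YangMills.Theorems.FluctuationComparisonRegPrIntLS2BetaAveragedBondWord
import HarnessLib

/-!
# S2β · (REG-UP)′ → (O3-a) bridge «O-PROFILE»: the oscillation letter `O_k` of ✓p840777 `hOSC_regUp_closed` is `≤ o·(L^{2k}·q)` with an EXPLICIT, level-independent `o`, given the
# one-power profiles of its physical letters (`δ_i, ε_i ≤ C·L^{2i}·q`, `r(i+1) ≤ C_r·L^{2i}·q`, transported size `Λ·L^k·M₀ ≤ m`, transported gradient `Λ·L^k·(ℓc₀) ≤ C_c·L^{2k}·q`) —
# pure real arithmetic (geometric sums), the `hOlev` input of w4 g29's `haA_of_profiles` ∕ (f0)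

Cell `ym3-torus` (YM ladder rung R3 = continuum `SU(2)` Yang–Mills on the three-torus at fixed lattice data — a RUNG: NOT d = 4, NOT infinite volume, NOT a mass gap,
NOT Clay).  Width seat «width 12» `ym3-torus-px12` (gen 27); crux `stmt-QuantumFields-20520`, LINE g18-1 S2β, c₁ column (architect px17 g23 03:56:06Z (d): «px12 keeps the analytic profile
letters — ratio from the knot»).  `--kind proof --supports stmt-QuantumFields-20520 --as helper`, count-neutral, DEFINITION-FREE (0 `def`, 0 `instance`, 0 `notation`, 0 `sorry`, default
heartbeats).  PURE REAL ARITHMETIC: no lattice object; the left side is the `O_k` of ✓p840777 symbol for symbol with `D := d·3L`, `Dm := (d−1)·2L`, `ℓℓ := (d+2)L`, `c := ℓ·c₀`, `M₀ := ‖Xd 0‖`,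
real powers `L^(k−i)` (the consumer `push_cast`s the knot's `((L^(k−i) : ℕ) : ℝ)`).

WHAT IS PROVED (sorry-free).  §1 geometric sums: `sum_pow_two_mul_le` (`Σ_{i<k} L^{2i} ≤ L^{2k}∕(L²−1)`), `sum_pow_add_le` (`Σ_{i<k} L^{k+i} ≤ L^{2k}∕(L−1)`), `sum_mixed_le`
(`Σ_{i<k} L^{k−1−i}·L^{2i} ≤ L^{2k}∕(L²−L)`, px20 g25 ✓`geom_mixed_sum`); §2 `sum_beta_le` (the per-level defects summed: `Σ_{i<k} β_i ≤ (2·67·ℓℓ∕a)·(2·Dm·Cδ∕(L²−1) + (2Cε+Cδ)∕(L−1))·(L^{2k}·q)`),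
`rowShare_eq` (`Λ·L^{k−1−i}·(β_i·(Λ·L^i))·M₀ = (Λ·L^k·M₀)·(Λ∕L)·β_i` inside the sum); §3 ★★★**`oscLetter_le_profile`** — the bound of the module title with
`o = 2·D·(2·Cε·m + m·(Λ∕L)·((2·67·ℓℓ∕a)·(2·Dm·Cδ∕(L²−1) + (2·Cε+Cδ)∕(L−1))) + Cc + 2·(Λ·Cr∕(L²−L)))`.

HONEST SCOPE.  Arithmetic; nothing of Bałaban's renormalisation-group analysis proved; the profiles of `δ, ε, r, c₀` and the size letter `m` are HYPOTHESES (BKG class ✓p839707, line recursion ✓p840574,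
C-M ⧗px20, (REG)@rep gradient); K-uniformity of `Λ_k` (`Σ_{j<k} α_j ≤ Cα∕(L²−1)` for `L^{2k}q ≤ 1`) is one more line for the consumer; (f0)∕(O3-a) (w4), GAP♯∘ (`stub_uniformFibreGapOrbit`, registry
3732b7df UNTOUCHED, 0∕5), the five registered stubs, S2β, crux 20520, 19936, 19200, `YM3TorusSU2` — NOT proved; rung R3 — NOT d = 4, NOT infinite volume, NOT a mass gap, NOT Clay; the
Yang–Mills mass gap is NOT proved.
-/

set_option autoImplicit false

namespace Summit.QuantumFields.YangMills.Theorems.FluctuationComparisonRegPrIntLS2BetaOscillationProfile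

open Summit.QuantumFields.YangMills.Theorems.FluctuationComparisonRegPrIntLS2BetaAveragedBondWord (geom_mixed_sum)

/-! ## §1 Geometric sums -/

/-- `Σ_{i<k} L^{2i} ≤ L^{2k}∕(L² − 1)` for `L > 1`. [folklore] -/
theorem sum_pow_two_mul_le {L : ℝ} (hL : 1 < L) (k : ℕ) :
    ∑ i ∈ Finset.range k, L ^ (2 * i) ≤ L ^ (2 * k) / (L ^ 2 - 1) := by
  have hL2 : 1 < L ^ 2 := by nlinarith
  have hne : L ^ 2 ≠ 1 := ne_of_gt hL2
  have e : ∑ i ∈ Finset.range k, L ^ (2 * i) = ((L ^ 2) ^ k - 1) / (L ^ 2 - 1) := by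
    rw [← geom_sum_eq hne k]
    refine Finset.sum_congr rfl fun i _ => ?_
    rw [pow_mul]
  rw [e, ← pow_mul, div_le_div_iff_of_pos_right (by linarith)]
  linarith

/-- `Σ_{i<k} L^{k+i} ≤ L^{2k}∕(L − 1)` for `L > 1`. [folklore] -/
theorem sum_pow_add_le {L : ℝ} (hL : 1 < L) (k : ℕ) :
    ∑ i ∈ Finset.range k, L ^ (k + i) ≤ L ^ (2 * k) / (L - 1) := by
  have hne : L ≠ 1 := ne_of_gt hL
  have e : ∑ i ∈ Finset.range k, L ^ (k + i) = L ^ k * ((L ^ k - 1) / (L - 1)) := by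
    rw [← geom_sum_eq hne k, Finset.mul_sum]
    refine Finset.sum_congr rfl fun i _ => ?_
    rw [pow_add]
  have hLk : 0 < L ^ k := pow_pos (by linarith) k
  rw [e, mul_div_assoc', div_le_div_iff_of_pos_right (by linarith), two_mul, pow_add]
  nlinarith

/-- `Σ_{i<k} L^{k−1−i}·L^{2i} ≤ L^{2k}∕(L² − L)` for `L > 1` (px20 g25 ✓`geom_mixed_sum`). [folklore] -/
theorem sum_mixed_le {L : ℝ} (hL : 1 < L) (k : ℕ) :
    ∑ i ∈ Finset.range k, L ^ (k - 1 - i) * L ^ (2 * i) ≤ L ^ (2 * k) / (L ^ 2 - L) := by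
  rw [geom_mixed_sum L hL k, div_le_div_iff_of_pos_right (by nlinarith)]
  have : 0 ≤ L ^ k := pow_nonneg (by linarith) k
  linarith

/-! ## §2 The per-level defects summed -/

/-- ★ `Σ_{i<k} β_i ≤ (2·67·ℓℓ∕a)·(2·Dm·Cδ∕(L²−1) + (2Cε+Cδ)∕(L−1))·(L^{2k}·q)` for `β_i = 2·(67·(ℓℓ·(Dm·δ_i + (Dm·δ_i + L^{k−i}·(2ε_i + δ_i)))))∕a` under the one-power profiles of `δ, ε`. [folklore] -/
theorem sum_beta_le {L q a ℓℓ Dm Cδ Cε : ℝ} (hL : 1 < L) (hq : 0 ≤ q) (ha : 0 < a) (hℓℓ : 0 ≤ ℓℓ) (hDm : 0 ≤ Dm) (hCδ : 0 ≤ Cδ) (hCε : 0 ≤ Cε) (k : ℕ) (δ ε : ℕ → ℝ)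
    (hδ : ∀ i, i ≤ k → 0 ≤ δ i ∧ δ i ≤ Cδ * L ^ (2 * i) * q) (hε : ∀ i, i ≤ k → 0 ≤ ε i ∧ ε i ≤ Cε * L ^ (2 * i) * q) :
    ∑ i ∈ Finset.range k, 2 * (67 * (ℓℓ * (Dm * δ i + (Dm * δ i + L ^ (k - i) * (2 * ε i + δ i))))) / a ≤
      (2 * 67 * ℓℓ / a) * (2 * Dm * Cδ / (L ^ 2 - 1) + (2 * Cε + Cδ) / (L - 1)) * (L ^ (2 * k) * q) := by
  have hL0 : 0 ≤ L := by linarith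
  -- termwise: `Dm·δ_i + (Dm·δ_i + L^{k−i}(2ε_i+δ_i)) ≤ q·(2·Dm·Cδ·L^{2i} + (2Cε+Cδ)·L^{k+i})`
  have hterm : ∀ i ∈ Finset.range k, 2 * (67 * (ℓℓ * (Dm * δ i + (Dm * δ i + L ^ (k - i) * (2 * ε i + δ i))))) / a ≤
      (2 * 67 * ℓℓ / a) * (q * (2 * Dm * Cδ * L ^ (2 * i) + (2 * Cε + Cδ) * L ^ (k + i))) := by
    intro i hi
    rw [Finset.mem_range] at hi
    obtain ⟨hδ0, hδi⟩ := hδ i hi.le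
    obtain ⟨hε0, hεi⟩ := hε i hi.le
    have hpow : L ^ (k - i) * L ^ (2 * i) = L ^ (k + i) := by rw [← pow_add]; congr 1; omega
    have hLki : 0 ≤ L ^ (k - i) := pow_nonneg hL0 _
    have h1 : Dm * δ i ≤ Dm * (Cδ * L ^ (2 * i) * q) := mul_le_mul_of_nonneg_left hδi hDm
    have h2 : L ^ (k - i) * (2 * ε i + δ i) ≤ L ^ (k - i) * ((2 * Cε + Cδ) * L ^ (2 * i) * q) :=
      mul_le_mul_of_nonneg_left (by nlinarith) hLki
    have h3 : L ^ (k - i) * ((2 * Cε + Cδ) * L ^ (2 * i) * q) = (2 * Cε + Cδ) * L ^ (k + i) * q := by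
      rw [← hpow]; ring
    rw [div_eq_mul_one_div, show (2 : ℝ) * 67 * ℓℓ / a = 2 * 67 * ℓℓ * (1 / a) by ring]
    have h1a : 0 ≤ 1 / a := by positivity
    nlinarith [h1, h2, h3, hℓℓ, h1a, mul_nonneg hℓℓ h1a]
  refine (Finset.sum_le_sum hterm).trans ?_
  rw [← Finset.mul_sum, ← Finset.mul_sum, Finset.sum_add_distrib, ← Finset.mul_sum, ← Finset.mul_sum]
  have hs1 := sum_pow_two_mul_le hL k
  have hs2 := sum_pow_add_le hL k
  have hC0 : 0 ≤ 2 * 67 * ℓℓ / a := by positivity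
  rw [mul_assoc (2 * 67 * ℓℓ / a)]
  refine mul_le_mul_of_nonneg_left ?_ hC0
  have hL1 : 0 < L - 1 := by linarith
  have hL21 : 0 < L ^ 2 - 1 := by nlinarith
  have t1 : q * (2 * Dm * Cδ) * ∑ i ∈ Finset.range k, L ^ (2 * i) ≤ q * (2 * Dm * Cδ) * (L ^ (2 * k) / (L ^ 2 - 1)) :=
    mul_le_mul_of_nonneg_left hs1 (by positivity)
  have t2 : q * (2 * Cε + Cδ) * ∑ i ∈ Finset.range k, L ^ (k + i) ≤ q * (2 * Cε + Cδ) * (L ^ (2 * k) / (L - 1)) :=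
    mul_le_mul_of_nonneg_left hs2 (by positivity)
  have e1 : q * ((2 * Dm * Cδ) * ∑ i ∈ Finset.range k, L ^ (2 * i) + (2 * Cε + Cδ) * ∑ i ∈ Finset.range k, L ^ (k + i)) =
      q * (2 * Dm * Cδ) * ∑ i ∈ Finset.range k, L ^ (2 * i) + q * (2 * Cε + Cδ) * ∑ i ∈ Finset.range k, L ^ (k + i) := by ring
  have e2 : (2 * Dm * Cδ / (L ^ 2 - 1) + (2 * Cε + Cδ) / (L - 1)) * (L ^ (2 * k) * q) =
      q * (2 * Dm * Cδ) * (L ^ (2 * k) / (L ^ 2 - 1)) + q * (2 * Cε + Cδ) * (L ^ (2 * k) / (L - 1)) := by ring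
  rw [e1, e2]
  exact add_le_add t1 t2

/-! ## §3 The oscillation letter against the one-power profile -/

/-- ★★★ **THE OSCILLATION LETTER OF ✓p840777 AGAINST THE ONE-POWER PROFILE**: with `θ := L^{2k}·q`, under `δ_i, ε_i ≤ C·L^{2i}·q` (`i ≤ k`), `r(i+1) ≤ Cr·L^{2i}·q` (`i < k`),
the transported size `Λ·L^k·M₀ ≤ m` and the transported gradient `Λ·L^k·c ≤ Cc·θ`:
`2·D·((2·ε_k·(Λ·L^k·M₀) + (Σ_{i<k} Λ·L^{k−1−i}·(β_i·(Λ·L^i)))·M₀ + Λ·L^k·c) + 2·Σ_{i<k} Λ·L^{k−1−i}·r(i+1)) ≤ o·θ`,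
`o = 2·D·(2·Cε·m + m·(Λ∕L)·((2·67·ℓℓ∕a)·(2·Dm·Cδ∕(L²−1) + (2Cε+Cδ)∕(L−1))) + Cc + 2·(Λ·Cr∕(L²−L)))` — ONE scale power, as [Balaban1985RegularSpaces] (1.36) prints.
[cite: Balaban1985RegularSpaces, (1.36) p.82; Balaban1985Averaging, Prop. 4 (128)-(135) pp.37-38] -/
theorem oscLetter_le_profile {L q a ℓℓ D Dm Λ M₀ m c Cδ Cε Cr Cc : ℝ} (hL : 1 < L) (hq : 0 ≤ q) (ha : 0 < a) (hℓℓ : 0 ≤ ℓℓ) (hD : 0 ≤ D) (hDm : 0 ≤ Dm)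
    (hΛ : 0 ≤ Λ) (hM₀ : 0 ≤ M₀) (hCδ : 0 ≤ Cδ) (hCε : 0 ≤ Cε) (hCr : 0 ≤ Cr) (k : ℕ) (δ ε r : ℕ → ℝ)
    (hδ : ∀ i, i ≤ k → 0 ≤ δ i ∧ δ i ≤ Cδ * L ^ (2 * i) * q) (hε : ∀ i, i ≤ k → 0 ≤ ε i ∧ ε i ≤ Cε * L ^ (2 * i) * q)
    (hr : ∀ i, i < k → 0 ≤ r (i + 1) ∧ r (i + 1) ≤ Cr * L ^ (2 * i) * q)
    (hM : Λ * L ^ k * M₀ ≤ m) (hc : Λ * L ^ k * c ≤ Cc * (L ^ (2 * k) * q)) :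
    2 * D * ((2 * ε k * (Λ * L ^ k * M₀) +
          (∑ i ∈ Finset.range k, Λ * L ^ (k - 1 - i) * ((2 * (67 * (ℓℓ * (Dm * δ i + (Dm * δ i + L ^ (k - i) * (2 * ε i + δ i))))) / a) * (Λ * L ^ i))) * M₀ +
          Λ * L ^ k * c) +
        2 * ∑ i ∈ Finset.range k, Λ * L ^ (k - 1 - i) * r (i + 1)) ≤
      2 * D * (2 * Cε * m + m * (Λ / L) * ((2 * 67 * ℓℓ / a) * (2 * Dm * Cδ / (L ^ 2 - 1) + (2 * Cε + Cδ) / (L - 1))) + Cc + 2 * (Λ * Cr / (L ^ 2 - L))) *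
        (L ^ (2 * k) * q) := by
  have hL0 : 0 < L := by linarith
  have hLk : 0 < L ^ k := pow_pos hL0 k
  have hm0 : 0 ≤ m := le_trans (by positivity) hM
  have hθ0 : 0 ≤ L ^ (2 * k) * q := by positivity
  -- (1) the line term `2·ε_k·(Λ·L^k·M₀) ≤ 2·Cε·m·θ`
  obtain ⟨hεk0, hεk⟩ := hε k le_rfl
  have h1 : 2 * ε k * (Λ * L ^ k * M₀) ≤ 2 * Cε * m * (L ^ (2 * k) * q) := by
    have hΛM : 0 ≤ Λ * L ^ k * M₀ := by positivity
    have hCε : 0 ≤ Cε * L ^ (2 * k) * q := hεk0.trans hεk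
    nlinarith [mul_le_mul hεk hM hΛM hCε]
  -- (2) the row share: each summand is `(Λ·L^k·M₀)·(Λ∕L)·β_i`, and `Σ β_i` is bounded by §2
  have hβ0 : ∀ i ∈ Finset.range k, 0 ≤ 2 * (67 * (ℓℓ * (Dm * δ i + (Dm * δ i + L ^ (k - i) * (2 * ε i + δ i))))) / a := by
    intro i hi
    rw [Finset.mem_range] at hi
    obtain ⟨hδ0, _⟩ := hδ i hi.le
    obtain ⟨hε0, _⟩ := hε i hi.le
    positivity
  have hrow : (∑ i ∈ Finset.range k, Λ * L ^ (k - 1 - i) * ((2 * (67 * (ℓℓ * (Dm * δ i + (Dm * δ i + L ^ (k - i) * (2 * ε i + δ i))))) / a) * (Λ * L ^ i))) * M₀ =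
      (Λ * L ^ k * M₀) * (Λ / L) * ∑ i ∈ Finset.range k, 2 * (67 * (ℓℓ * (Dm * δ i + (Dm * δ i + L ^ (k - i) * (2 * ε i + δ i))))) / a := by
    rw [Finset.mul_sum, Finset.sum_mul]
    refine Finset.sum_congr rfl fun i hi => ?_
    rw [Finset.mem_range] at hi
    have hpow : L ^ (k - 1 - i) * L ^ i * L = L ^ k := by
      rw [← pow_add, ← pow_succ]; congr 1; omega
    field_simp
    rw [← hpow]
    ring
  have hSumB := sum_beta_le hL hq ha hℓℓ hDm hCδ hCε k δ ε hδ hε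
  have h2 : (∑ i ∈ Finset.range k, Λ * L ^ (k - 1 - i) * ((2 * (67 * (ℓℓ * (Dm * δ i + (Dm * δ i + L ^ (k - i) * (2 * ε i + δ i))))) / a) * (Λ * L ^ i))) * M₀ ≤
      m * (Λ / L) * ((2 * 67 * ℓℓ / a) * (2 * Dm * Cδ / (L ^ 2 - 1) + (2 * Cε + Cδ) / (L - 1))) * (L ^ (2 * k) * q) := by
    rw [hrow]
    have hSum0 : 0 ≤ ∑ i ∈ Finset.range k, 2 * (67 * (ℓℓ * (Dm * δ i + (Dm * δ i + L ^ (k - i) * (2 * ε i + δ i))))) / a := Finset.sum_nonneg hβ0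
    have hΛL : 0 ≤ Λ / L := by positivity
    calc (Λ * L ^ k * M₀) * (Λ / L) * ∑ i ∈ Finset.range k, 2 * (67 * (ℓℓ * (Dm * δ i + (Dm * δ i + L ^ (k - i) * (2 * ε i + δ i))))) / a
        ≤ m * (Λ / L) * ((2 * 67 * ℓℓ / a) * (2 * Dm * Cδ / (L ^ 2 - 1) + (2 * Cε + Cδ) / (L - 1)) * (L ^ (2 * k) * q)) :=
          mul_le_mul (mul_le_mul_of_nonneg_right hM hΛL) hSumB hSum0 (by positivity)
      _ = _ := by ring
  -- (3) the second-order share: `Σ Λ·L^{k−1−i}·r(i+1) ≤ Λ·Cr·q·Σ L^{k−1−i}L^{2i} ≤ (Λ·Cr∕(L²−L))·θ`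
  have h3 : ∑ i ∈ Finset.range k, Λ * L ^ (k - 1 - i) * r (i + 1) ≤ Λ * Cr / (L ^ 2 - L) * (L ^ (2 * k) * q) := by
    have hterm : ∀ i ∈ Finset.range k, Λ * L ^ (k - 1 - i) * r (i + 1) ≤ (Λ * Cr * q) * (L ^ (k - 1 - i) * L ^ (2 * i)) := by
      intro i hi
      rw [Finset.mem_range] at hi
      obtain ⟨_, hri⟩ := hr i hi
      have hLp : 0 ≤ Λ * L ^ (k - 1 - i) := by positivity
      calc Λ * L ^ (k - 1 - i) * r (i + 1) ≤ Λ * L ^ (k - 1 - i) * (Cr * L ^ (2 * i) * q) := mul_le_mul_of_nonneg_left hri hLp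
        _ = (Λ * Cr * q) * (L ^ (k - 1 - i) * L ^ (2 * i)) := by ring
    refine (Finset.sum_le_sum hterm).trans ?_
    rw [← Finset.mul_sum]
    have hc0 : 0 ≤ Λ * Cr * q := by positivity
    calc (Λ * Cr * q) * ∑ i ∈ Finset.range k, L ^ (k - 1 - i) * L ^ (2 * i) ≤ (Λ * Cr * q) * (L ^ (2 * k) / (L ^ 2 - L)) :=
          mul_le_mul_of_nonneg_left (sum_mixed_le hL k) hc0
      _ = Λ * Cr / (L ^ 2 - L) * (L ^ (2 * k) * q) := by ring
  -- assemble
  have hinner : (2 * ε k * (Λ * L ^ k * M₀) +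
        (∑ i ∈ Finset.range k, Λ * L ^ (k - 1 - i) * ((2 * (67 * (ℓℓ * (Dm * δ i + (Dm * δ i + L ^ (k - i) * (2 * ε i + δ i))))) / a) * (Λ * L ^ i))) * M₀ +
        Λ * L ^ k * c) + 2 * ∑ i ∈ Finset.range k, Λ * L ^ (k - 1 - i) * r (i + 1) ≤
      (2 * Cε * m + m * (Λ / L) * ((2 * 67 * ℓℓ / a) * (2 * Dm * Cδ / (L ^ 2 - 1) + (2 * Cε + Cδ) / (L - 1))) + Cc + 2 * (Λ * Cr / (L ^ 2 - L))) *
        (L ^ (2 * k) * q) := by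
    nlinarith [h1, h2, h3, hc]
  calc _ ≤ 2 * D * ((2 * Cε * m + m * (Λ / L) * ((2 * 67 * ℓℓ / a) * (2 * Dm * Cδ / (L ^ 2 - 1) + (2 * Cε + Cδ) / (L - 1))) + Cc + 2 * (Λ * Cr / (L ^ 2 - L))) *
        (L ^ (2 * k) * q)) := mul_le_mul_of_nonneg_left hinner (by positivity)
    _ = _ := by ring

end Summit.QuantumFields.YangMills.Theorems.FluctuationComparisonRegPrIntLS2BetaOscillationProfile
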